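/-
Copyright (c) 2026. All rights reserved.
Released under Apache 2.0 license as described in the file LICENSE.
Authors: abc-iut cell, prover seat abc-iut-w5-d144 (gen 6; row «COR510iv-SB′», brick E input «D1b-TS»), over abc-iut-L4-t3's
`IotaOverTS` / `LamOverLink` add-ons, abc-iut-L4-t5's `logObsFamilyTS`; twin of this seat's `LogFrobeniusObservablesOver.lean`.
-/
import Literature.AnabelianGeometry.AbsoluteAnabelian.Ltimes.LogFrobeniusObservablesTSOver
import Literature.AnabelianGeometry.AbsoluteAnabelian.Ltimes.LogFrobeniusLamOverLink
import Literature.AnabelianGeometry.AbsoluteAnabelian.Ltimes.LogFrobeniusObservablesTSOfIotaSquare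
import Literature.AnabelianGeometry.AbsoluteAnabelian.DiagramChainFamiliesOver
import Literature.AnabelianGeometry.AbsoluteAnabelian.DiagramOverTransport
import HarnessLib

/-!
# [AbsTopIII] Cor 5.5 (iii) / Def 5.4 (iv)(vii): the homotopies of the observable `S_log_v` (the `TS`-valued half) lie over `Th•[Z]`

S. Mochizuki, *Topics in absolute anabelian geometry III: global reconstruction algorithms*,
J. Math. Sci. Univ. Tokyo 22 (2015) 939–1156 [MochizukiAbsTopIII2015]; manuscript `paper:url-5493eb38cbb7`: Def 5.4 (iv)
p. 127 ("`λ_{v,ν}` … obtained by composing … with `𝒩⊞_v → 𝒩_v` … lie over `Th•[Z]`"), (vii) p. 128 (the `ι_{v,ε}`), Cor 5.5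
(iii) p. 131 (the observable `S_log_v` on the portion of `D•_{≤3}` indexed by `v`, observation vertex `𝒩_v`), Rmk 3.5.1 p. 78.

The `TS` twin of `LogFrobeniusObservablesOver.lean`.  The observable's diagram `(D•_{≤3})_v ∪ {𝒩_v}` (`logDiagramTS v`) LIES
OVER `Th•[Z] = ℰ•` through `𝒳_⋎, □ ↦ proj`, `𝒩⊞_w ↦ (𝒩⊞_w → 𝒩_w → Th•[Z])`, `𝒩_v ↦ (𝒩_v → Th•[Z])`, the arrows lying over by
`logOver`, the unitor, `lamOver w ν` and — for the observation arrow `𝒩⊞_v → 𝒩_v` — the identity (`logTSOverE v`).  With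
respect to it:

* `isOver_logGenHomTS` — GIVEN abc-iut-L4-t3's add-ons `IotaOverTS T` (the `TS`-valued `ι_{v,ε}` lie over `Th•[Z]`) and
  `LamOverLink`, both printed kinds of generator pairs of `S_log_v` (abc-iut-L4-t5's `LogGenTS.pre` / `.post`, homotopy
  `logGenHomTS`) carry OVER-homotopies;
* `isOver_logObsFamilyTS_η` — ★ hence EVERY homotopy of abc-iut-L4-t5's constructed `logObsFamilyTS v T hsqTS` lies over
  `Th•[Z]` (this seat's `isOver_chainFamily_η`): the hypothesis «hoverTS» of the Cor 5.10 (iv)(b) compatibility closer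
  (row «COR510iv-SB′», abc-iut-f-101's brick D2) in over-datum form; `_map` over any category under `Th•[Z]`.

Interface-level (hypotheses `IotaOverTS`, `LamOverLink`, `IotaSquaresCommuteTS`; no carrier); nothing here bears on
[IUTchIII] Cor. 3.12; no side taken; typed ≠ proved.

**`⋉`-TWIN (cell row «LTIMES-SUCCESSOR», L4-lead m162; typing finding T3g9-F1).**  This file is the verbatim
re-elaboration of `LogFrobeniusObservablesTSOver.lean` over the successor interface `LogFrobeniusSettingLtimes`
(`Ltimes/LogFrobeniusCompatibility.lean`: `ι⊞_{v,ε}` indexed by the edges of `Γ⃗^⋉_v` at EVERY place, [AbsTopIII] Cor 5.5 (iii)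
p. 131), produced by the cell recipe `LTIMES-RECIPE.md`: names carry over inside `namespace LogFrobeniusSettingLtimes`, the
section variable is `Lt`, setting-independent declarations are NOT repeated (the originals are in scope), statements and
proofs are otherwise unchanged.  The original file over the frozen interface stays as it is.
NEW BASENAME `Ltimes/LogFrobeniusObservablesTSOverGenerators` (abc-iut-f-101 gen 6, slice T9-E «OBS@⋉-CARRIERS»): §2–§4 of the
frozen `LogFrobeniusObservablesTSOver` — bookkeeping, the `IotaOverTS` component lemmas, the structure isomorphisms along the
`TS` generator paths and ★ the over-ness of `logObsFamilyTS` (`isOver_logGenHomTS`, `isOver_logObsFamilyTS_η(_map)` = the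
`hoverTS` binder of the E-instance), GIVEN `T.IotaOverTS` and `LamOverLink` over ⋉; §1 (`logTSOverE`) is the landed
`Ltimes/LogFrobeniusObservablesTSOver`.
-/

universe u

open CategoryTheory Quiver

namespace Literature.AnabelianGeometry.AbsoluteAnabelian

namespace LogFrobeniusSettingLtimes

variable {Vmod : Type u} {isArc : Vmod → Bool} (Lt : LogFrobeniusSettingLtimes Vmod isArc) (v : Vmod)

/-! ## Bookkeeping -/

/-- `F.map` respects heterogeneous equality of morphisms with equal endpoints. [folklore] -/
private theorem map_heqTS {C₁ D₁ : Type*} [Category C₁] [Category D₁] (F : C₁ ⥤ D₁) {X Y X' Y' : C₁} {f : X ⟶ Y} {g : X' ⟶ Y'}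
    (hX : X = X') (hY : Y = Y') (h : HEq f g) : HEq (F.map f) (F.map g) := by
  subst hX hY
  cases h
  rfl

/-- Components of a natural transformation at equal objects are heterogeneously equal. [folklore] -/
private theorem app_heqTS {C₁ D₁ : Type*} [Category C₁] [Category D₁] {F G : C₁ ⥤ D₁} (α : F ⟶ G) {y y' : C₁} (h : y = y') :
    HEq (α.app y) (α.app y') := by
  subst h
  rfl

/-- Cancellation `f ∘ A⁻¹ ∘ A = f` for components of a natural isomorphism (bookkeeping, stated for clean rewriting).
[folklore] -/
private theorem comp_inv_hom_app {C₁ D₁ : Type*} [Category C₁] [Category D₁] {F G : C₁ ⥤ D₁} (α : F ≅ G) (y : C₁) {W : D₁}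
    (f : W ⟶ G.obj y) : (f ≫ α.inv.app y) ≫ α.hom.app y = f := by
  simp

/-- Cancellation `g ∘ f ∘ A⁻¹ ∘ A = g ∘ f` (bookkeeping). [folklore] -/
private theorem comp_comp_inv_hom_app {C₁ D₁ : Type*} [Category C₁] [Category D₁] {F G : C₁ ⥤ D₁} (α : F ≅ G) (y : C₁)
    {W W' : D₁} (g : W ⟶ W') (f : W' ⟶ G.obj y) : ((g ≫ f) ≫ α.inv.app y) ≫ α.hom.app y = g ≫ f := by
  simp

/-- The empty path at `𝒳_{⋎+1}` of the portion (bookkeeping abbreviation). [cite: MochizukiAbsTopIII2015, Definition 3.5 (i) p.75] -/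
private abbrev nilRow1TS (n : ℤ) :
    Quiver.Path ((logShapeTS (isArc := isArc) v).base ⟨DVertex.row1 (n + 1), row1_mem_portion v (n + 1)⟩)
      ((logShapeTS (isArc := isArc) v).base ⟨DVertex.row1 (n + 1), row1_mem_portion v (n + 1)⟩) :=
  Quiver.Path.nil

/-- The path functor of the empty path on objects. [cite: MochizukiAbsTopIII2015, Definition 3.5 (i) p.75] -/
private theorem pf_nil_objTS (c : (logShapeTS (isArc := isArc) v).Vertex) (x : (Lt.logDiagramTS v).obj c) :
    ((Lt.logDiagramTS v).pathFunctor (Quiver.Path.nil : Quiver.Path c c)).obj x = x :=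
  (Lt.logDiagramTS v).pathFunctor_nil_obj c x

/-! ## The `TS`-valued `ι_{v,ε}` over `Th•[Z]`, componentwise (from `IotaOverTS`) -/

variable {Lt} in
/-- Along a PRE-log edge: `(𝒩_v → Th•[Z])(ι_{v,ε,X}) ≍ A_{ν₁,X} ∘ A_{ν₂,X}⁻¹` (`A := lamOver`).
[cite: MochizukiAbsTopIII2015, Def 5.4 (vii) p. 128] -/
theorem TSHomotopies.IotaOverTS.toE_map_iota_heq_of_preLog {T : Lt.TSHomotopies} (hι : T.IotaOverTS) (v : Vmod)
    {ν₁ ν₂ : LogVertex (isArc v)} (ε : LogEdgeTS (isArc v) ν₁ ν₂) (h₁ : ν₁.isPostLog = false) (X₀ : Lt.X) :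
    HEq ((Lt.toE v).map ((T.iota v ε).app X₀)) ((Lt.lamOver v ν₁).hom.app X₀ ≫ (Lt.lamOver v ν₂).inv.app X₀) := by
  rw [hι.app v ε X₀]
  have k : ((frobeniusTwist Lt.log ν₁.isPostLog ⋙ Lt.lam v ν₁) ⋙ Lt.forget v ⋙ Lt.toE v).obj X₀ =
      (Lt.lam v ν₁ ⋙ Lt.forget v ⋙ Lt.toE v).obj X₀ := by
    rw [h₁]; rfl
  exact heq_comp k rfl rfl (Lt.lamTwistOver_hom_app_heq_of_preLog v ν₁ h₁ X₀) HEq.rfl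

variable {Lt} in
/-- Along a POST-log edge, through the space-link's over-structure (GIVEN `LamOverLink`):
`(𝒩_v → Th•[Z])(ι_{v,ε,X}) ≍ A_{space-link, log X} ∘ Ξ_X ∘ A_{ν₂,X}⁻¹`. [cite: MochizukiAbsTopIII2015, Cor 5.5 p. 130] -/
theorem TSHomotopies.IotaOverTS.toE_map_iota_heq_spaceLink {T : Lt.TSHomotopies} (hι : T.IotaOverTS) (hΛ : Lt.LamOverLink) (v : Vmod)
    {ν₁ ν₂ : LogVertex (isArc v)} (ε : LogEdgeTS (isArc v) ν₁ ν₂) (h₁ : ν₁.isPostLog = true) (X₀ : Lt.X) :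
    HEq ((Lt.toE v).map ((T.iota v ε).app X₀))
      ((Lt.lamOver v (LogVertex.spaceLink (isArc v))).hom.app (Lt.log.obj X₀) ≫ Lt.logOver.hom.app X₀ ≫
        (Lt.lamOver v ν₂).inv.app X₀) := by
  rw [hι.app v ε X₀]
  have k : ((frobeniusTwist Lt.log ν₁.isPostLog ⋙ Lt.lam v ν₁) ⋙ Lt.forget v ⋙ Lt.toE v).obj X₀ =
      (Lt.lam v ν₁ ⋙ Lt.forget v ⋙ Lt.toE v).obj (Lt.log.obj X₀) := by
    rw [h₁]; rfl
  refine ((heq_comp k rfl rfl (Lt.lamTwistOver_hom_app_heq_of_postLog v ν₁ h₁ X₀) HEq.rfl).trans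
    (heq_of_eq (Category.assoc _ _ _))).trans ?_
  obtain rfl : ν₁ = LogVertex.postLog (isArc v) := LogVertex.eq_postLog_of_isPostLog _ h₁
  have k' : (Lt.lam v (LogVertex.postLog (isArc v)) ⋙ Lt.forget v ⋙ Lt.toE v).obj (Lt.log.obj X₀) =
      (Lt.lam v (LogVertex.spaceLink (isArc v)) ⋙ Lt.forget v ⋙ Lt.toE v).obj (Lt.log.obj X₀) := by
    rw [Lt.lam_spaceLink_eq_postLog v]
  exact heq_comp k' rfl rfl (hΛ.hom_app_heq v (Lt.log.obj X₀)).symm HEq.rfl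

/-! ## The structure isomorphisms along the `TS`-observable's generator paths, componentwise -/

/-- Along `[𝒩⊞_v → 𝒩_v] ∘ [λ⊞_{v,ν}]`: the structure isomorphism is `lamOver v ν`.
[cite: MochizukiAbsTopIII2015, Def 5.4 (iv) p. 127] -/
theorem pathIso_lamPathTS_hom_app_heq (ν : LogVertex (isArc v)) (hν : ν.isPostLog = false) (x : Lt.X) :
    HEq (((Lt.logTSOverE v).pathIso (lamPathTS v ν hν)).hom.app x) ((Lt.lamOver v ν).hom.app x) := by
  have hy₀ := Lt.pf_nil_objTS v ((logShapeTS (isArc := isArc) v).base ⟨.core, core_mem_portion v⟩) x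
  have hy₁ : ((Lt.logDiagramTS v).pathFunctor (Path.nil.cons (lamEdgeTS v ν hν))).obj x = (Lt.lam v ν).obj x :=
    (Functor.congr_obj ((Lt.logDiagramTS v).pathFunctor_cons Path.nil (lamEdgeTS v ν hν)) x).trans
      (congrArg (Lt.lam v ν).obj hy₀)
  rw [show lamPathTS (isArc := isArc) v ν hν = (Path.nil.cons (lamEdgeTS v ν hν)).cons (forgetEdgeTS v) from rfl]
  -- `erw`: `logTSOverE`/`logDiagramTS` (successor) live over the ⋉-copy of `obsShape`, the generator paths over the exported
  -- frozen `logShapeTS` — equal up to unfolding only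
  erw [DiagramOfCategories.OverData.pathIso_cons_app, DiagramOfCategories.OverData.pathIso_cons_app,
    DiagramOfCategories.OverData.pathIso_nil_app, logTSOverE_μ_lamEdgeTS, logTSOverE_μ_forgetEdgeTS]
  refine (eqToHom_comp_heq _ _).trans ?_
  have e1 : HEq ((Iso.refl (DEdge.functorLtimes Lt (DEdge.forget v) ⋙ Lt.toE v)).hom.app
      (((Lt.logDiagramTS v).pathFunctor (Path.nil.cons (lamEdgeTS v ν hν))).obj x))
      (𝟙 ((Lt.lam v ν ⋙ Lt.forget v ⋙ Lt.toE v).obj x)) := by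
    rw [hy₁]
    exact heq_of_eq (by simp; rfl)
  have e2 : HEq ((Lt.lamOver v ν).hom.app (((Lt.logDiagramTS v).pathFunctor (Quiver.Path.nil : Quiver.Path ((logShapeTS (isArc := isArc) v).base ⟨DVertex.core, core_mem_portion v⟩) ((logShapeTS (isArc := isArc) v).base ⟨DVertex.core, core_mem_portion v⟩))).obj x))
      ((Lt.lamOver v ν).hom.app x) := app_heqTS _ hy₀
  refine (heq_comp (by rw [hy₁]; try rfl) (by rw [hy₁]; try rfl) rfl e1
    ((eqToHom_comp_heq _ _).trans ((comp_eqToHom_heq _ _).trans e2))).trans ?_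
  exact heq_of_eq (Category.id_comp _)

/-- Along `[𝒩⊞_v → 𝒩_v] ∘ [λ⊞_{ν₂}] ∘ [id_{⋎+1}]`: the structure isomorphism is `lamOver v ν₂`.
[cite: MochizukiAbsTopIII2015, Def 5.4 (iv) p. 127] -/
theorem pathIso_postLogCodPathTS_hom_app_heq (n : ℤ) (ν₂ : LogVertex (isArc v)) (h₂ : ν₂.isPostLog = false) (x : Lt.X) :
    HEq (((Lt.logTSOverE v).pathIso (postLogCodPathTS v n ν₂ h₂)).hom.app x) ((Lt.lamOver v ν₂).hom.app x) := by
  have hy₀ := Lt.pf_nil_objTS v ((logShapeTS (isArc := isArc) v).base ⟨.row1 (n + 1), row1_mem_portion v (n + 1)⟩) x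
  have hy₁ : ((Lt.logDiagramTS v).pathFunctor (Path.nil.cons (toCoreEdgeTS v (n + 1)))).obj x = x :=
    (Functor.congr_obj ((Lt.logDiagramTS v).pathFunctor_cons Path.nil (toCoreEdgeTS v (n + 1))) x).trans hy₀
  have hy₂ : ((Lt.logDiagramTS v).pathFunctor ((Path.nil.cons (toCoreEdgeTS v (n + 1))).cons (lamEdgeTS v ν₂ h₂))).obj x =
      (Lt.lam v ν₂).obj x :=
    (Functor.congr_obj ((Lt.logDiagramTS v).pathFunctor_cons (Path.nil.cons (toCoreEdgeTS v (n + 1)))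
      (lamEdgeTS v ν₂ h₂)) x).trans (congrArg (Lt.lam v ν₂).obj hy₁)
  erw [show postLogCodPathTS (isArc := isArc) v n ν₂ h₂ =
      ((Path.nil.cons (toCoreEdgeTS v (n + 1))).cons (lamEdgeTS v ν₂ h₂)).cons (forgetEdgeTS v) from rfl]
  -- `erw`: `logTSOverE`/`logDiagramTS` (successor) live over the ⋉-copy of `obsShape`, the generator paths over the exported
  -- frozen `logShapeTS` — equal up to unfolding only
  erw [DiagramOfCategories.OverData.pathIso_cons_app, DiagramOfCategories.OverData.pathIso_cons_app,
    DiagramOfCategories.OverData.pathIso_cons_app, DiagramOfCategories.OverData.pathIso_nil_app,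
    logTSOverE_μ_lamEdgeTS, logTSOverE_μ_forgetEdgeTS, logTSOverE_μ_toCoreEdgeTS]
  refine (eqToHom_comp_heq _ _).trans ?_
  have e1 : HEq ((Iso.refl (DEdge.functorLtimes Lt (DEdge.forget v) ⋙ Lt.toE v)).hom.app
      (((Lt.logDiagramTS v).pathFunctor ((Path.nil.cons (toCoreEdgeTS v (n + 1))).cons (lamEdgeTS v ν₂ h₂))).obj x))
      (𝟙 ((Lt.lam v ν₂ ⋙ Lt.forget v ⋙ Lt.toE v).obj x)) := by
    erw [hy₂]
    exact heq_of_eq (by simp; rfl)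
  have e2 : HEq ((Lt.lamOver v ν₂).hom.app (((Lt.logDiagramTS v).pathFunctor (Path.nil.cons (toCoreEdgeTS v (n + 1)))).obj x))
      ((Lt.lamOver v ν₂).hom.app x) := app_heqTS _ hy₁
  have e3 : HEq (Lt.proj.leftUnitor.hom.app (((Lt.logDiagramTS v).pathFunctor (nilRow1TS (isArc := isArc) v n)).obj x))
      (𝟙 (Lt.proj.obj x)) := by
    erw [hy₀]
    exact heq_of_eq (by simp)
  have e23 : HEq ((Lt.lamOver v ν₂).hom.app (((Lt.logDiagramTS v).pathFunctor (Path.nil.cons (toCoreEdgeTS v (n + 1)))).obj x) ≫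
      (eqToHom (by erw [DiagramOfCategories.pathFunctor_cons]; try rfl) ≫
        Lt.proj.leftUnitor.hom.app (((Lt.logDiagramTS v).pathFunctor (nilRow1TS (isArc := isArc) v n)).obj x) ≫
        eqToHom (by erw [DiagramOfCategories.pathFunctor_nil]; try rfl)))
      ((Lt.lamOver v ν₂).hom.app x ≫ 𝟙 (Lt.proj.obj x)) :=
    heq_comp (by erw [hy₁]) (congrArg (fun y => Lt.proj.obj y) hy₁) rfl e2
      ((eqToHom_comp_heq _ _).trans ((comp_eqToHom_heq _ _).trans e3))
  refine (heq_comp (by erw [hy₂]; try rfl) (by erw [hy₂]; try rfl) rfl e1 ((eqToHom_comp_heq _ _).trans e23)).trans ?_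
  exact heq_of_eq (by simp)

/-- Along `[𝒩⊞_v → 𝒩_v] ∘ [λ⊞_{space-link}] ∘ [id_⋎] ∘ [log]`: the structure isomorphism is `lamOver v space-link` at `log X`
followed by `logOver` at `X`. [cite: MochizukiAbsTopIII2015, Def 5.4 (ii) p. 125] -/
theorem pathIso_postLogDomPathTS_hom_app_heq (n : ℤ) (hsl : (LogVertex.spaceLink (isArc v)).isPostLog = false) (x : Lt.X) :
    HEq (((Lt.logTSOverE v).pathIso (postLogDomPathTS v n hsl)).hom.app x)
      ((Lt.lamOver v (LogVertex.spaceLink (isArc v))).hom.app (Lt.log.obj x) ≫ Lt.logOver.hom.app x) := by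
  have hy₀ := Lt.pf_nil_objTS v ((logShapeTS (isArc := isArc) v).base ⟨.row1 (n + 1), row1_mem_portion v (n + 1)⟩) x
  have hy₁ : ((Lt.logDiagramTS v).pathFunctor (Path.nil.cons (logEdgeTS v n))).obj x = Lt.log.obj x :=
    (Functor.congr_obj ((Lt.logDiagramTS v).pathFunctor_cons Path.nil (logEdgeTS v n)) x).trans (congrArg Lt.log.obj hy₀)
  have hy₂ : ((Lt.logDiagramTS v).pathFunctor ((Path.nil.cons (logEdgeTS v n)).cons (toCoreEdgeTS v n))).obj x =
      Lt.log.obj x :=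
    (Functor.congr_obj ((Lt.logDiagramTS v).pathFunctor_cons (Path.nil.cons (logEdgeTS v n)) (toCoreEdgeTS v n)) x).trans
      hy₁
  have hy₃ : ((Lt.logDiagramTS v).pathFunctor
      (((Path.nil.cons (logEdgeTS v n)).cons (toCoreEdgeTS v n)).cons (lamEdgeTS v _ hsl))).obj x =
      (Lt.lam v (LogVertex.spaceLink (isArc v))).obj (Lt.log.obj x) :=
    (Functor.congr_obj ((Lt.logDiagramTS v).pathFunctor_cons ((Path.nil.cons (logEdgeTS v n)).cons (toCoreEdgeTS v n))
      (lamEdgeTS v _ hsl)) x).trans (congrArg (Lt.lam v (LogVertex.spaceLink (isArc v))).obj hy₂)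
  erw [show postLogDomPathTS (isArc := isArc) v n hsl =
      ((((Path.nil.cons (logEdgeTS v n)).cons (toCoreEdgeTS v n)).cons (lamEdgeTS v _ hsl)).cons (forgetEdgeTS v))
      from rfl]
  -- `erw`: `logTSOverE`/`logDiagramTS` (successor) live over the ⋉-copy of `obsShape`, the generator paths over the exported
  -- frozen `logShapeTS` — equal up to unfolding only
  erw [DiagramOfCategories.OverData.pathIso_cons_app, DiagramOfCategories.OverData.pathIso_cons_app,
    DiagramOfCategories.OverData.pathIso_cons_app, DiagramOfCategories.OverData.pathIso_cons_app,
    DiagramOfCategories.OverData.pathIso_nil_app,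
    logTSOverE_μ_lamEdgeTS, logTSOverE_μ_forgetEdgeTS, logTSOverE_μ_toCoreEdgeTS, logTSOverE_μ_logEdgeTS]
  refine (eqToHom_comp_heq _ _).trans ?_
  have e1 : HEq ((Iso.refl (DEdge.functorLtimes Lt (DEdge.forget v) ⋙ Lt.toE v)).hom.app (((Lt.logDiagramTS v).pathFunctor
      (((Path.nil.cons (logEdgeTS v n)).cons (toCoreEdgeTS v n)).cons (lamEdgeTS v _ hsl))).obj x))
      (𝟙 ((Lt.lam v (LogVertex.spaceLink (isArc v)) ⋙ Lt.forget v ⋙ Lt.toE v).obj (Lt.log.obj x))) := by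
    erw [hy₃]
    exact heq_of_eq (by simp; rfl)
  have e2 : HEq ((Lt.lamOver v (LogVertex.spaceLink (isArc v))).hom.app
      (((Lt.logDiagramTS v).pathFunctor ((Path.nil.cons (logEdgeTS v n)).cons (toCoreEdgeTS v n))).obj x))
      ((Lt.lamOver v (LogVertex.spaceLink (isArc v))).hom.app (Lt.log.obj x)) := app_heqTS _ hy₂
  have e3 : HEq (Lt.proj.leftUnitor.hom.app (((Lt.logDiagramTS v).pathFunctor (Path.nil.cons (logEdgeTS v n))).obj x))
      (𝟙 (Lt.proj.obj (Lt.log.obj x))) := by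
    erw [hy₁]
    exact heq_of_eq (by simp)
  have e4 : HEq (Lt.logOver.hom.app (((Lt.logDiagramTS v).pathFunctor (nilRow1TS (isArc := isArc) v n)).obj x))
      (Lt.logOver.hom.app x) := app_heqTS _ hy₀
  have e34 : HEq (Lt.proj.leftUnitor.hom.app (((Lt.logDiagramTS v).pathFunctor (Path.nil.cons (logEdgeTS v n))).obj x) ≫
      (eqToHom (by erw [DiagramOfCategories.pathFunctor_cons]; try rfl) ≫
        Lt.logOver.hom.app (((Lt.logDiagramTS v).pathFunctor (nilRow1TS (isArc := isArc) v n)).obj x) ≫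
        eqToHom (by erw [DiagramOfCategories.pathFunctor_nil]; try rfl)))
      (𝟙 (Lt.proj.obj (Lt.log.obj x)) ≫ Lt.logOver.hom.app x) :=
    heq_comp (congrArg (fun y => Lt.proj.obj y) hy₁) (congrArg (fun y => Lt.proj.obj y) hy₁) rfl e3
      ((eqToHom_comp_heq _ _).trans ((comp_eqToHom_heq _ _).trans e4))
  have e234 : HEq ((Lt.lamOver v (LogVertex.spaceLink (isArc v))).hom.app
      (((Lt.logDiagramTS v).pathFunctor ((Path.nil.cons (logEdgeTS v n)).cons (toCoreEdgeTS v n))).obj x) ≫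
      (eqToHom (by erw [DiagramOfCategories.pathFunctor_cons]; try rfl) ≫
        (Lt.proj.leftUnitor.hom.app (((Lt.logDiagramTS v).pathFunctor (Path.nil.cons (logEdgeTS v n))).obj x) ≫
        (eqToHom (by erw [DiagramOfCategories.pathFunctor_cons]; try rfl) ≫
          Lt.logOver.hom.app (((Lt.logDiagramTS v).pathFunctor (nilRow1TS (isArc := isArc) v n)).obj x) ≫
          eqToHom (by erw [DiagramOfCategories.pathFunctor_nil]; try rfl)))))
      ((Lt.lamOver v (LogVertex.spaceLink (isArc v))).hom.app (Lt.log.obj x) ≫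
        (𝟙 (Lt.proj.obj (Lt.log.obj x)) ≫ Lt.logOver.hom.app x)) :=
    heq_comp (by erw [hy₂]; try rfl) (by erw [hy₂]; try rfl) rfl e2 ((eqToHom_comp_heq _ _).trans e34)
  refine (heq_comp (by erw [hy₃]; try rfl) (by erw [hy₃]; try rfl) rfl e1 ((eqToHom_comp_heq _ _).trans e234)).trans ?_
  exact heq_of_eq (by simp)

/-! ## The generator homotopies of `S_log_v` lie over `Th•[Z]` -/

/-- **Both printed kinds of generator pairs of `S_log_v` carry OVER-homotopies**, GIVEN `IotaOverTS T` and `LamOverLink`.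
[cite: MochizukiAbsTopIII2015, Def 5.4 (vii) p. 128] -/
theorem isOver_logGenHomTS (T : Lt.TSHomotopies) (hι : T.IotaOverTS) (hΛ : Lt.LamOverLink) :
    ∀ ⦃c b : (logShapeTS (isArc := isArc) v).Vertex⦄ ⦃g g' : Path c b⦄ (s : LogGenTS v g g'),
      (Lt.logTSOverE v).IsOver g g' (Lt.logGenHomTS v T s)
  | _, _, _, _, LogFrobeniusSetting.LogGenTS.pre ν₁ ν₂ ε h₁ h₂ => by
    refine (Iso.eq_comp_inv _).mpr ?_
    ext x
    rw [NatTrans.comp_app, Functor.whiskerRight_app]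
    apply eq_of_heq
    refine HEq.trans ?_ (Lt.pathIso_lamPathTS_hom_app_heq v ν₁ h₁ x).symm
    have hθ : HEq (((Lt.logTSOverE v).N (logShapeTS (isArc := isArc) v).obs).map
        ((Lt.logGenHomTS v T (LogFrobeniusSetting.LogGenTS.pre ν₁ ν₂ ε h₁ h₂)).app x))
        ((Lt.lamOver v ν₁).hom.app x ≫ (Lt.lamOver v ν₂).inv.app x) := by
      have k : HEq ((Lt.logGenHomTS v T (LogFrobeniusSetting.LogGenTS.pre ν₁ ν₂ ε h₁ h₂)).app x) ((T.iota v ε).app x) := by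
        simp only [logGenHomTS, NatTrans.comp_app, eqToHom_app]
        exact (eqToHom_comp_heq _ _).trans (comp_eqToHom_heq _ _)
      exact (map_heqTS (Lt.toE v) (Functor.congr_obj (Lt.pathFunctor_lamPathTS v ν₁ h₁) x)
        (Functor.congr_obj (Lt.pathFunctor_lamPathTS' v ν₂ h₂) x).symm k).trans (hι.toE_map_iota_heq_of_preLog v ε h₁ x)
    have hP := Lt.pathIso_lamPathTS_hom_app_heq v ν₂ h₂ x
    refine (heq_comp ?_ ?_ rfl hθ hP).trans (heq_of_eq (comp_inv_hom_app (Lt.lamOver v ν₂) x _))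
    · exact (congrArg (fun F => (Lt.toE v).obj (F.obj x)) (Lt.pathFunctor_lamPathTS v ν₁ h₁)).trans (by rw [h₁]; try rfl)
    · exact congrArg (fun F => (Lt.toE v).obj (F.obj x)) (Lt.pathFunctor_lamPathTS' v ν₂ h₂).symm
  | _, _, _, _, LogFrobeniusSetting.LogGenTS.post ν₁ ν₂ ε h₁ h₂ hsl n => by
    refine (Iso.eq_comp_inv _).mpr ?_
    ext x
    rw [NatTrans.comp_app, Functor.whiskerRight_app]
    apply eq_of_heq
    refine HEq.trans ?_ (Lt.pathIso_postLogDomPathTS_hom_app_heq v n hsl x).symm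
    have hθ : HEq (((Lt.logTSOverE v).N (logShapeTS (isArc := isArc) v).obs).map
        ((Lt.logGenHomTS v T (LogFrobeniusSetting.LogGenTS.post ν₁ ν₂ ε h₁ h₂ hsl n)).app x))
        (((Lt.lamOver v (LogVertex.spaceLink (isArc v))).hom.app (Lt.log.obj x) ≫ Lt.logOver.hom.app x) ≫
          (Lt.lamOver v ν₂).inv.app x) := by
      have k : HEq ((Lt.logGenHomTS v T (LogFrobeniusSetting.LogGenTS.post ν₁ ν₂ ε h₁ h₂ hsl n)).app x) ((T.iota v ε).app x) := by
        simp only [logGenHomTS, NatTrans.comp_app, eqToHom_app]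
        exact (eqToHom_comp_heq _ _).trans (comp_eqToHom_heq _ _)
      refine (map_heqTS (Lt.toE v) (Functor.congr_obj (Lt.pathFunctor_postLogDomPathTS v ν₁ h₁ n hsl) x)
        (Functor.congr_obj (Lt.pathFunctor_postLogCodPathTS v n ν₂ h₂) x).symm k).trans ?_
      exact (hι.toE_map_iota_heq_spaceLink hΛ v ε h₁ x).trans (heq_of_eq (Category.assoc _ _ _).symm)
    have hP := Lt.pathIso_postLogCodPathTS_hom_app_heq v n ν₂ h₂ x
    refine (heq_comp ?_ ?_ rfl hθ hP).trans (heq_of_eq (comp_comp_inv_hom_app (Lt.lamOver v ν₂) x _ _))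
    · refine (congrArg (fun F => (Lt.toE v).obj (F.obj x)) (Lt.pathFunctor_postLogDomPathTS v ν₁ h₁ n hsl)).trans ?_
      rw [h₁, LogVertex.eq_postLog_of_isPostLog _ h₁, ← Lt.lam_spaceLink_eq_postLog v]
      rfl
    · exact congrArg (fun F => (Lt.toE v).obj (F.obj x)) (Lt.pathFunctor_postLogCodPathTS v n ν₂ h₂).symm

/-- ★ **Every homotopy of abc-iut-L4-t5's constructed observable `S_log_v` lies over `Th•[Z]`** (GIVEN `IotaOverTS`,
`LamOverLink`, and the `TS`-square hypothesis under which `logObsFamilyTS` exists): the hypothesis «hoverTS» of the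
Cor 5.10 (iv)(b) compatibility closer in over-datum form. [cite: MochizukiAbsTopIII2015, Cor 5.5 (iii) p. 131] -/
theorem isOver_logObsFamilyTS_η (T : Lt.TSHomotopies) (hι : T.IotaOverTS) (hΛ : Lt.LamOverLink)
    (hsq : Lt.IotaSquaresCommuteTS T v) {a b : (logShapeTS (isArc := isArc) v).Vertex} {p q : Path a b}
    (h : (Lt.logObsFamilyTS v T hsq).E p q) :
    (Lt.logTSOverE v).IsOver p q ((Lt.logObsFamilyTS v T hsq).η h) :=
  DiagramOfCategories.isOver_chainFamily_η (Lt.logTSOverE v) (LogGenTS v) (Lt.logGenHomTS v T)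
    (Lt.isOver_logGenHomTS v T hι hΛ) (logShapeTS v).obs (isEmpty_hom_logObsTS v)
    (fun p q c c' => Lt.chain_hom_eq_TS v T hsq p q c c') h

/-- The same over any category under `Th•[Z]` (abc-iut-f-101's `IsOver.map`). [cite: MochizukiAbsTopIII2015, Cor 5.10 (iv)(b) p. 147] -/
theorem isOver_logObsFamilyTS_η_map (T : Lt.TSHomotopies) (hι : T.IotaOverTS) (hΛ : Lt.LamOverLink)
    (hsq : Lt.IotaSquaresCommuteTS T v) {C' : Type (u + 1)} [Category.{u} C'] (F : Lt.E ⥤ C')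
    {a b : (logShapeTS (isArc := isArc) v).Vertex} {p q : Path a b} (h : (Lt.logObsFamilyTS v T hsq).E p q) :
    ((Lt.logTSOverE v).map F).IsOver p q ((Lt.logObsFamilyTS v T hsq).η h) :=
  DiagramOfCategories.OverData.IsOver.map F (Lt.isOver_logObsFamilyTS_η v T hι hΛ hsq h)

end LogFrobeniusSettingLtimes

end Literature.AnabelianGeometry.AbsoluteAnabelian
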